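import Literature.Geometry.Kaehler.ComplexTorusWeilTypeUnitaryGroupDet
import Literature.Geometry.Kaehler.ComplexTorusWeilTypePolarization
import Literature.Geometry.Kaehler.ComplexTorusStablyNondegenerateIffNoTypeIIIAndHodgeEqLefschetz
import Literature.Geometry.Kaehler.ComplexTorusDualAbelianVariety
import HarnessLib

/-!
# A complex torus of Weil type whose Weil operator is CENTRAL in `End⁰(X)` is stably degenerate:
# `Hg(X) ⊊ S(X)(ℝ)` («the Hodge group is strictly contained in `Sp_D(V,φ)`»), hence `ℬ•(Xⁿ) ≠ 𝒟•(Xⁿ)` for some `n`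

[topic Geometry/Kaehler]

Layer `Literature/Geometry/Kaehler`, namespace `Literature.Geometry.Kaehler.ComplexTorus`; lane `lit-hodgefound` (Track 2
foundations library), Layer A4 (cycle classes on abelian varieties: Weil classes, Hodge and Lefschetz groups); prover seat
`lit-hodgefound-p17` (generation 54), self-proposed row g54-#2 — the ENGINE of Moonen–Zarhin's Thm. (0.1) (1) in case (a)
(«The Hodge group `Hg(X)` is strictly contained in `Sp_D(V,φ)`», proved in (5.3) by «The Hodge group acts trivially on `W_k`,
i.e., its elements have trivial `k`-linear determinant»), isolated as a statement about ANY polarised complex torus `X`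
carrying `α ∈ End⁰(X)` with `α² = −d`, acting on `T₀X` with multiplicities `(n, n)` (Weil type), and CENTRAL in `End⁰(X)`.
THEOREMS ONLY (no definition, no instance, no notation, no named fact; D-0026, net debt 0).  Everything is consumed BY NAME.

## The argument

For such `(X, α)` and a polarisation `E` with `ρ(α)^*E = dE` (one exists: Lange §7.2.4 Exercise (7), the tree's
`IsRiemannForm.exists_isRiemannForm_twoForm_eq_mul`):
1. `Hg(X)(ℝ) ⊆ SU_H(ℝ)` — every element of the Hodge group has `k ⊗ ℝ`-determinant `det κ(r) = 1` on the `2n`-dimensional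
   eigenspace `U₊ ⊂ H¹(X, ℂ)` (van Geemen 6.9, proof of 6.11; the tree's `IsWeilType.hodgeGroup_le_weilSpecialUnitaryGroup`,
   `IsWeilType.mem_weilSpecialUnitaryGroup_iff_det_letterMatrix`).  THIS is «the Hodge group acts trivially on `W_k`».
2. The units of `k ⊗ ℝ = ℂ` act on `V_ℝ = T₀X` through `α`: `u_φ = cos φ · 1 + (sin φ/√d) · ρ(α)`.  They preserve `E`
   (`ρ(α)` is `E`-skew with `ρ(α)^*E = dE`), and they commute with `End⁰(X)` BECAUSE `α` IS CENTRAL — so `u_φ ∈ S(X)(ℝ)`, the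
   centraliser of `End⁰(X)` in `Sp(V_ℝ, E)` (the tree's `lefschetzGroup`, Milne's `S(X)`, Moonen–Zarhin's `Sp_D(V,φ)`).
3. `u_φ` multiplies every `√-d`-eigen-covector `dz_j` (`b_j ∈ E₊`) by `e^{iφ}` and every `dz̄_j` (`b_j ∈ E₋`) by
   `conj(e^{-iφ}) = e^{iφ}`: its letter matrix is `κ(u_φ) = e^{iφ} · 1_{2n}`, `det κ(u_φ) = e^{2niφ}`, which is `−1` for
   `φ = π/2n`.  So `u_{π/2n} ∈ S(X)(ℝ) ∖ SU_H(ℝ) ⊆ S(X)(ℝ) ∖ Hg(X)(ℝ)`: **`Hg(X)(ℝ) ⊊ S(X)(ℝ)`**.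
4. By Hazama–Murty ∕ Gordon Thm. 7.5 (1) ⟹ (2) (the tree's A4-103
   `IsRiemannForm.forall_divisorClasses_powPeriod_eq_hodgeClasses_iff_eq_and_hodgeGroup_eq_lefschetzGroup`), `X` is NOT stably
   nondegenerate: `𝒟ᵖ(Xᵏ) ≠ ℬᵖ(Xᵏ)` for some `k, p`.
When `α` is not central (e.g. `k ⊂ D` a quaternion algebra, Moonen–Zarhin's case (c)) step 2 fails and indeed `Hg(X) = Sp_D(V,φ)`
may hold; the centrality hypothesis is essential.

## Sources, VERBATIM

* B. J. J. Moonen, Yu. G. Zarhin [MoonenZarhin1999LowDim], *Hodge classes on abelian varieties of low dimension*, Math. Ann.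
  **315** (1999) 711–733, held `paper:arxiv-math_9901113`.  Thm. (0.1) (1) (p0001 L102–L105): «Suppose we are in case (a) or
  (b). Then the Hodge ring `ℬ•(X)` is generated by the subalgebra `𝒟•(X)` of divisor classes together with the space of Weil
  classes `W_k ⊂ ℬ²(X)`. The Hodge group `Hg(X)` is strictly contained in `Sp_D(V,φ)`.»; (5.3) (p0009 L1–L22): «Embed `k` as
  a subfield of `End⁰(X)` such that it acts with multiplicities `(2,2)` on the tangent space `T_{X,0}`. … Then the space
  `W_k ⊂ H⁴(X,ℚ)` consists of Hodge classes. … The Hodge group acts trivially on `W_k`, i.e., its elements have trivial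
  `k`-linear determinant. We then easily find that we must have `Hg(X) = {(u₁,u₂) ∈ 𝕌_k × 𝕌_F | u₁ · det_k(u₂) = 1}`»;
  §1 (p0004 L74–L87, Hazama–Murty): «`Hg(X) = Sp_D(V,φ)` ⟺ `X` has no factors of type III and `𝒟•(Xⁿ) = ℬ•(Xⁿ)` for all `n`».
* B. van Geemen [vanGeemen1994HodgeAV], *An introduction to the Hodge conjecture for abelian varieties*, LNM 1594 (1994), 6.9
  («`κ : r_{B,C} ↦ B + √-d C` … `SU_H` … `det(B + √-d C) = 1`»), proof of Thm. 6.11, first step («`h(S¹) ⊂ SU_H(ℝ)` … the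
  fact that `h(z)` has `n` eigenvalues `z` and `n` eigenvalues `z̄`»), 6.4 (`Hg` the smallest `ℚ`-group containing `h(S¹)`).
* H. Lange [Lange2023AbelianVarietiesComplex], *Abelian Varieties over the Complex Numbers* (2023), §7.2.4 Exercises (6)–(8)
  (polarised abelian varieties of Weil type, `ρ(√-d)^*H = dH`, `Hg(X) ⊆ SU_H`), §7.2.4 Exercise (4) (the Lefschetz group).
* B. B. Gordon [Gordon1999HodgeAVSurvey], *A survey of the Hodge conjecture for abelian varieties*, Thm. 7.5 (1) ⟺ (2)
  («`Hdg(Aᵏ) = Div(Aᵏ)` for all `k ≥ 1` ⟺ `A` has no factor of type (III), and `Hg(A) = Lf(A)`»).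
* J. S. Milne [Milne1999LefschetzClasses], *Lefschetz classes on abelian varieties*, Duke Math. J. **96** (1999), §1 (`S(A)`),
  §4 Prop. 4.8.

## Contents

* §1 the letter matrix of `u_φ = cos φ · 1 + (sin φ/√d) · α ⊗ 1`: **`IsWeilType.letterMatrix_eq_exp_smul_one_of_analyticRepReal_eq`**
  (`κ(u_φ) = e^{iφ} · 1`), `IsWeilType.det_letterMatrix_eq_exp_pow_of_analyticRepReal_eq` (`det κ(u_φ) = e^{2niφ}`).
* §2 `u_φ` preserves every polarisation `E` with `ρ(α)^*E = dE` (`forall_twoForm_cos_add_sin_eq`) and commutes with `End⁰(X)`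
  when `α` is central; **`IsWeilType.exists_mem_lefschetzGroup_not_mem_weilSpecialUnitaryGroup`** (`u_{π/2n} ∈ S(X)(ℝ) ∖ SU_H(ℝ)`).
* §3 **`IsWeilType.hodgeGroup_lt_lefschetzGroup_of_forall_comm`** — `Hg(X)(ℝ) ⊊ S(X)(ℝ)` («strictly contained in
  `Sp_D(V,φ)`») for CENTRAL Weil type and a compatible polarisation; `IsPolarizedWeilType.hodgeGroup_lt_lefschetzGroup_of_forall_comm`;
  `IsWeilType.exists_isRiemannForm_hodgeGroup_lt_lefschetzGroup_of_forall_comm` (some polarisation).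
* §4 **`IsWeilType.exists_divisorClasses_powPeriod_ne_hodgeClasses_of_forall_comm`** — a complex abelian variety of CENTRAL Weil
  type is stably degenerate: `𝒟ᵖ(Xᵏ) ≠ ℬᵖ(Xᵏ)` for some `k, p`; `IsAbelianVariety.not_forall_divisorClasses_powPeriod_eq_hodgeClasses_of_isWeilType_of_forall_comm`.
-/

noncomputable section

open scoped ComplexConjugate
open Module Matrix Complex Function
open Literature.Analysis.Complex Literature.Analysis.Complex.WeilOperator

namespace Literature.Geometry.Kaehler

namespace ComplexTorus

/-! ## §1 The letter matrix of `u_φ = cos φ · 1 + (sin φ / √d) · (α ⊗ 1)` is `e^{iφ} · 1` -/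

section Letters

variable {ι : Type*} [Fintype ι] [DecidableEq ι] {E : Type*} [NormedAddCommGroup E] [NormedSpace ℂ E]
  [FiniteDimensional ℂ E] {Φ : (ι → ℝ) ≃L[ℝ] E} {α : Matrix ι ι ℚ} {d n : ℕ}

/-- `cos φ + sin φ · i = e^{iφ}` with real `cos`, `sin` cast to `ℂ`. [folklore] -/
private theorem cwd_cos_add_sin_mul_I (φ : ℝ) : (Real.cos φ : ℂ) + (Real.sin φ : ℂ) * I = Complex.exp (φ * I) := by
  rw [Complex.exp_mul_I, Complex.ofReal_cos, Complex.ofReal_sin]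

/-- `dz_j(b_l) = δ_{jl}`: the coordinate covectors are dual to the eigenbasis. [folklore] -/
private theorem cwd_coordCLM_eigenBasis {T : E →L[ℂ] E} {d' : ℝ} (hd : 0 < d') (hT : ∀ v, T (T v) = -((d' : ℂ) • v))
    (j l : Idx T d') : WeilOperator.coordCLM hd hT j (WeilOperator.eigenBasis hd hT l) = if j = l then 1 else 0 := by
  change (WeilOperator.eigenBasis hd hT).coord j (WeilOperator.eigenBasis hd hT l) = _
  rw [Basis.coord_apply, Basis.repr_self, Finsupp.single_apply]
  simp only [eq_comm]

/-- **`κ(u_φ) = e^{iφ} · 1_{2n}`**: for a complex torus of Weil type `(X, √-d ↦ α)` and a real matrix `P` acting on `V_ℝ = T₀X`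
as `u_φ = cos φ · 1 + (sin φ/√d) · ρ(α)` (the unit `e^{iφ}` of `k ⊗ ℝ = ℂ` acting through `α`), the matrix of `u_φ^*` on the
`√-d`-eigenspace `U₊ ⊂ H¹(X, ℂ)` in the eigen-letter basis is the scalar `e^{iφ}`: `u_φ` is `e^{iφ}` on `E₊` (letters `dz_j`) and
`e^{-iφ}` on `E₋` (letters `dz̄_j`, which conjugate the scalar).  («`κ : r_{B,C} ↦ B + √-d C`»; cf. the tree's
`IsWeilType.letterMatrix_hodgeCircle` for `h(e^{iθ})`, which is `e^{iθ}` on the `dz`'s and `e^{-iθ}` on the `dz̄`'s.)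
[cite: vanGeemen1994HodgeAV, 6.9 and proof of Thm. 6.11 (first step)] [cite: MoonenZarhin1999LowDim, §5 (5.3) (p0009 L17–L22: «trivial `k`-linear determinant»)] -/
theorem IsWeilType.letterMatrix_eq_exp_smul_one_of_analyticRepReal_eq (h : IsWeilType Φ α d n) (φ : ℝ) {P : Matrix ι ι ℝ}
    (hP : analyticRepReal Φ Φ P = Real.cos φ • ContinuousLinearMap.id ℝ E +
      (Real.sin φ / Real.sqrt d) • (analyticRepHom Φ ⟨α, h.mem_endAlgRat⟩).restrictScalars ℝ) :
    h.letterMatrix P = Complex.exp (φ * I) • (1 : Matrix (Fin (2 * n)) (Fin (2 * n)) ℂ) := by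
  set e := idxEquiv h.pos_real h.sq_real h.finrank_eq with he
  have hsqrt : (Real.sqrt d : ℂ) ≠ 0 := Complex.ofReal_ne_zero.2 (Real.sqrt_pos.2 h.pos_real).ne'
  -- the coordinates of `u_φ b_l` in the eigenbasis: `dz_j(u_φ b_l) = (cos φ + ε_j sin φ · i) δ_{jl}`
  have hcoord : ∀ j l : Idx (analyticRepHom Φ ⟨α, h.mem_endAlgRat⟩) (d : ℝ),
      WeilOperator.coordCLM h.pos_real h.sq_real j (analyticRepReal Φ Φ P (WeilOperator.eigenBasis h.pos_real h.sq_real l)) =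
        ((Real.cos φ : ℂ) + (sgn j : ℂ) * (Real.sin φ : ℂ) * I) * (if j = l then 1 else 0) := by
    intro j l
    rw [hP, _root_.add_apply, _root_.smul_apply, _root_.smul_apply,
      ContinuousLinearMap.id_apply, ContinuousLinearMap.coe_restrictScalars', ← Complex.coe_smul, ← Complex.coe_smul, map_add,
      map_smul, map_smul, coordCLM_apply_apply, cwd_coordCLM_eigenBasis, smul_eq_mul, smul_eq_mul, sqrtNeg, Complex.ofReal_div]
    by_cases hjl : j = l
    · simp only [hjl, if_true]
      field_simp
    · simp only [hjl, if_false]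
      ring
  ext a l
  rw [IsWeilType.letterMatrix_apply, plusWord, ← he, Matrix.smul_apply, Matrix.one_apply, smul_eq_mul]
  rcases hb : (e a).isRight with _ | _
  · -- an `E₊`-letter `dz_j`: `ε = 1`
    have hsgn : (sgn (e a) : ℂ) = 1 := by
      rcases hj : e a with i | i
      · simp [WeilOperator.sgn]
      · rw [hj, Sum.isRight_inr] at hb; exact absurd hb (by decide)
    rw [pqLetter_false_apply, hcoord, hsgn, one_mul, cwd_cos_add_sin_mul_I]
    simp only [EmbeddingLike.apply_eq_iff_eq]
  · -- an `E₋`-letter `dz̄_j`: `ε = -1`, and the letter conjugates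
    have hsgn : (sgn (e a) : ℂ) = -1 := by
      rcases hj : e a with i | i
      · rw [hj, Sum.isRight_inl] at hb; exact absurd hb (by decide)
      · simp [WeilOperator.sgn]
    rw [pqLetter_true_apply, hcoord, hsgn, map_mul]
    have hconj : conj ((Real.cos φ : ℂ) + (-1) * (Real.sin φ : ℂ) * I) = Complex.exp (φ * I) := by
      rw [← cwd_cos_add_sin_mul_I]
      simp only [map_add, map_mul, map_neg, map_one, Complex.conj_ofReal, Complex.conj_I]
      ring
    rw [hconj]
    simp only [EmbeddingLike.apply_eq_iff_eq, apply_ite (starRingEnd ℂ), map_one, map_zero]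

/-- **`det κ(u_φ) = e^{2niφ}`** (the `k ⊗ ℝ`-determinant of the unit `e^{iφ}` on the `2n`-dimensional `U₊`).
[cite: vanGeemen1994HodgeAV, 6.9 (`det(B + √-d C)`)] [cite: MoonenZarhin1999LowDim, §5 (5.3) (p0009 L17–L22)] -/
theorem IsWeilType.det_letterMatrix_eq_exp_pow_of_analyticRepReal_eq (h : IsWeilType Φ α d n) (φ : ℝ) {P : Matrix ι ι ℝ}
    (hP : analyticRepReal Φ Φ P = Real.cos φ • ContinuousLinearMap.id ℝ E +
      (Real.sin φ / Real.sqrt d) • (analyticRepHom Φ ⟨α, h.mem_endAlgRat⟩).restrictScalars ℝ) :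
    (h.letterMatrix P).det = Complex.exp (φ * I) ^ (2 * n) := by
  rw [h.letterMatrix_eq_exp_smul_one_of_analyticRepReal_eq φ hP, Matrix.det_smul, Matrix.det_one, mul_one, Fintype.card_fin]

end Letters

/-! ## §2 `u_φ` lies in `S(X)(ℝ)` (central `α`, compatible polarisation) but not in `SU_H(ℝ)` -/

section Unit

variable {ι : Type*} [Fintype ι] [DecidableEq ι] {E : Type*} [NormedAddCommGroup E] [NormedSpace ℂ E]
  {Φ : (ι → ℝ) ≃L[ℝ] E} {η : E [⋀^Fin 2]→L[ℝ] ℝ} {α : Matrix ι ι ℚ} {d : ℕ}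

/-- `ρ` is faithful on real matrices: `ρ(B) = ρ(C) ⟹ B = C`. [cite: Lange2023AbelianVarietiesComplex, §1.1.2 p. 20 (`ρ_r ⊗ 1` injective)] -/
private theorem cwd_analyticRepReal_injective {B C : Matrix ι ι ℝ} (h : analyticRepReal Φ Φ B = analyticRepReal Φ Φ C) :
    B = C := by
  refine Matrix.toLin'.injective (LinearMap.ext fun x ↦ ?_)
  have hx := congrArg (fun f : E →L[ℝ] E ↦ f (Φ x)) h
  simp only [analyticRepReal_apply] at hx
  rw [Matrix.toLin'_apply, Matrix.toLin'_apply]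
  exact Φ.injective hx

omit [DecidableEq ι] in
/-- `(B C) ⊗ ℝ = (B ⊗ ℝ)(C ⊗ ℝ)` for rational matrices. [folklore] -/
private theorem cwd_map_ratCast_mul (B C : Matrix ι ι ℚ) :
    (B * C).map (Rat.cast : ℚ → ℝ) = B.map (Rat.cast : ℚ → ℝ) * C.map (Rat.cast : ℚ → ℝ) := by
  have h := Matrix.map_mul (L := B) (M := C) (f := Rat.castHom ℝ)
  simpa only [Rat.coe_castHom] using h

/-- `ω(x, -y) = -ω(x, y)`. [folklore] -/
private theorem cwd_twoForm_neg_right (x y : E) : η ![x, -y] = -η ![x, y] := by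
  rw [← neg_one_smul ℝ y, twoForm_smul_right, neg_one_mul]

/-- `ρ(α)² = -d` on `V_ℝ` for `α² = -d` in `End_ℚ(X)` (real form of the tree's `analyticRepHom_sq_real`). [cite: Lange2023AbelianVarietiesComplex, §7.2.4 (p. 334)] -/
private theorem cwd_analyticRepReal_sq (hα : α ∈ endAlgRat Φ) (hα2 : α * α = -((d : ℚ) • (1 : Matrix ι ι ℚ))) (v : E) :
    analyticRepReal Φ Φ (α.map (Rat.cast : ℚ → ℝ)) (analyticRepReal Φ Φ (α.map (Rat.cast : ℚ → ℝ)) v) = -((d : ℝ) • v) := by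
  rw [← restrictScalars_analyticRepHom Φ hα, ContinuousLinearMap.coe_restrictScalars', analyticRepHom_sq_real Φ hα hα2 v,
    Complex.coe_smul]

/-- **`ρ(α)` is `E`-skew for a compatible polarisation**: `E(ρ(α)u, v) = -E(u, ρ(α)v)` from `ρ(α)^*E = dE` and `ρ(α)² = -d`
(the Rosati involution maps `√-d ↦ -√-d`, Lange's Exercise 7.2.4 (6)). [cite: Lange2023AbelianVarietiesComplex, §7.2.4 Exercise (6)] -/
theorem twoForm_analyticRepReal_left_eq_neg_of_forall_twoForm_eq_mul (hα : α ∈ endAlgRat Φ) (hd : 0 < d)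
    (hα2 : α * α = -((d : ℚ) • (1 : Matrix ι ι ℚ)))
    (hW : ∀ u v : E, η ![analyticRepReal Φ Φ (α.map (Rat.cast : ℚ → ℝ)) u,
      analyticRepReal Φ Φ (α.map (Rat.cast : ℚ → ℝ)) v] = d * η ![u, v]) (u v : E) :
    η ![analyticRepReal Φ Φ (α.map (Rat.cast : ℚ → ℝ)) u, v] = -η ![u, analyticRepReal Φ Φ (α.map (Rat.cast : ℚ → ℝ)) v] := by
  have h1 := hW u (analyticRepReal Φ Φ (α.map (Rat.cast : ℚ → ℝ)) v)
  rw [cwd_analyticRepReal_sq hα hα2, cwd_twoForm_neg_right, twoForm_smul_right] at h1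
  have hdℝ : (d : ℝ) ≠ 0 := Nat.cast_ne_zero.2 hd.ne'
  have h3 : (d : ℝ) * η ![analyticRepReal Φ Φ (α.map (Rat.cast : ℚ → ℝ)) u, v] =
      (d : ℝ) * (-η ![u, analyticRepReal Φ Φ (α.map (Rat.cast : ℚ → ℝ)) v]) := by linear_combination -h1
  exact mul_left_cancel₀ hdℝ h3

/-- **The units `u_φ = cos φ · 1 + (sin φ/√d) · ρ(α)` of `k ⊗ ℝ = ℂ`, acting through `α`, preserve every polarisation `E` with
`ρ(α)^*E = dE`**: `E(u_φ x, u_φ y) = (cos²φ + sin²φ) E(x, y)` (the cross terms cancel by skewness of `ρ(α)`).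
[cite: Lange2023AbelianVarietiesComplex, §7.2.4 Exercise (6)] [cite: MoonenZarhin1999LowDim, §5 (5.3) (p0009 L11–L16: `Hg(X) ⊆ 𝕌_k × …`)] -/
theorem forall_twoForm_cos_add_sin_eq (hα : α ∈ endAlgRat Φ) (hd : 0 < d) (hα2 : α * α = -((d : ℚ) • (1 : Matrix ι ι ℚ)))
    (hW : ∀ u v : E, η ![analyticRepReal Φ Φ (α.map (Rat.cast : ℚ → ℝ)) u,
      analyticRepReal Φ Φ (α.map (Rat.cast : ℚ → ℝ)) v] = d * η ![u, v]) (φ : ℝ) (x y : E) :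
    η ![Real.cos φ • x + (Real.sin φ / Real.sqrt d) • analyticRepReal Φ Φ (α.map (Rat.cast : ℚ → ℝ)) x,
        Real.cos φ • y + (Real.sin φ / Real.sqrt d) • analyticRepReal Φ Φ (α.map (Rat.cast : ℚ → ℝ)) y] = η ![x, y] := by
  have hskew := twoForm_analyticRepReal_left_eq_neg_of_forall_twoForm_eq_mul hα hd hα2 hW
  have hdℝ : (0 : ℝ) < d := Nat.cast_pos.2 hd
  have hsq : Real.sqrt d * Real.sqrt d = d := Real.mul_self_sqrt hdℝ.le
  have hs : Real.sin φ / Real.sqrt d * (Real.sin φ / Real.sqrt d) * d = Real.sin φ ^ 2 := by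
    rw [div_mul_div_comm, hsq, div_mul_cancel₀ _ hdℝ.ne', pow_two]
  have hcs : Real.cos φ ^ 2 + Real.sin φ ^ 2 = 1 := Real.cos_sq_add_sin_sq φ
  simp only [twoForm_add_left, twoForm_add_right, twoForm_smul_left, twoForm_smul_right]
  rw [hW, hskew x y]
  linear_combination (η ![x, y]) * hcs + (η ![x, y]) * hs

variable [FiniteDimensional ℂ E] {n : ℕ}

/-- **`u_{π/2n} ∈ S(X)(ℝ) ∖ SU_H(ℝ)`**: for a polarised complex torus of Weil type `(X, √-d ↦ α)` with `α` CENTRAL in `End⁰(X)` and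
`E` a polarisation with `ρ(α)^*E = dE`, the unit `u_φ`, `φ = π/2n`, lies in the centraliser of `End⁰(X)` in `Sp(V_ℝ, E)` (it is a
polynomial in the central `ρ(α)` and preserves `E`) but has `k ⊗ ℝ`-determinant `e^{iπ} = -1 ≠ 1` on `U₊`, so it is not in `SU_H(ℝ)`.
[cite: MoonenZarhin1999LowDim, §5 (5.3) (p0009 L17–L22) and Thm. (0.1) (1) (p0001 L102–L105)] [cite: vanGeemen1994HodgeAV, 6.9]
[cite: Lange2023AbelianVarietiesComplex, §7.2.4 Exercises (4), (6), (8)] -/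
theorem IsWeilType.exists_mem_lefschetzGroup_not_mem_weilSpecialUnitaryGroup (h : IsWeilType Φ α d n)
    (hη : IsRiemannForm Φ η)
    (hW : ∀ u v : E, η ![analyticRepReal Φ Φ (α.map (Rat.cast : ℚ → ℝ)) u,
      analyticRepReal Φ Φ (α.map (Rat.cast : ℚ → ℝ)) v] = d * η ![u, v])
    (hcent : ∀ A ∈ endAlgRat Φ, α * A = A * α) :
    ∃ M ∈ lefschetzGroup Φ η, M ∉ weilSpecialUnitaryGroup Φ η α d n := by
  set φ : ℝ := Real.pi / (2 * n) with hφ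
  set T := analyticRepReal Φ Φ (α.map (Rat.cast : ℚ → ℝ)) with hT
  set S : E →L[ℝ] E := Real.cos φ • ContinuousLinearMap.id ℝ E + (Real.sin φ / Real.sqrt d) • T with hS
  have hSapp : ∀ x, S x = Real.cos φ • x + (Real.sin φ / Real.sqrt d) • T x := fun x ↦ rfl
  -- `u_φ ∈ Sp(V_ℝ, E)`: realise `S` by a matrix of determinant one
  obtain ⟨M, hMsp, hMS⟩ := exists_mem_spGroup_analyticRepReal_eq Φ hη.nondegenerate S fun x y ↦ by
    rw [hSapp, hSapp]; exact forall_twoForm_cos_add_sin_eq h.mem_endAlgRat h.pos h.mul_self hW φ x y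
  have hMS' : analyticRepReal Φ Φ M.1 = Real.cos φ • ContinuousLinearMap.id ℝ E +
      (Real.sin φ / Real.sqrt d) • (analyticRepHom Φ ⟨α, h.mem_endAlgRat⟩).restrictScalars ℝ := by
    rw [hMS, hS, hT, restrictScalars_analyticRepHom]
  refine ⟨M, (mem_lefschetzGroup_iff Φ).2 ⟨hMsp, fun A hA ↦ ?_⟩, fun hSU ↦ ?_⟩
  · -- `u_φ` commutes with `End⁰(X)`: `ρ(α)` does (`α` central), hence so does `cos φ + (sin φ/√d) ρ(α)`
    have hTA : T.comp (analyticRepReal Φ Φ (A.map (Rat.cast : ℚ → ℝ))) = (analyticRepReal Φ Φ (A.map (Rat.cast : ℚ → ℝ))).comp T := by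
      rw [hT, ← analyticRepReal_mul Φ Φ Φ, ← analyticRepReal_mul Φ Φ Φ, ← cwd_map_ratCast_mul, ← cwd_map_ratCast_mul, hcent A hA]
    apply cwd_analyticRepReal_injective (Φ := Φ)
    rw [analyticRepReal_mul Φ Φ Φ, analyticRepReal_mul Φ Φ Φ, hMS]
    ext x
    have hTAx := congrArg (fun f : E →L[ℝ] E ↦ f x) hTA
    simp only [ContinuousLinearMap.comp_apply] at hTAx
    simp only [ContinuousLinearMap.comp_apply, hSapp, map_add, map_smul, hTAx]
  · -- but `det κ(u_φ) = e^{iπ} = -1`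
    have hdet := (h.mem_weilSpecialUnitaryGroup_iff_det_letterMatrix.1 hSU).2
    rw [h.det_letterMatrix_eq_exp_pow_of_analyticRepReal_eq φ hMS', ← Complex.exp_nat_mul] at hdet
    have hn : (n : ℂ) ≠ 0 := Nat.cast_ne_zero.2 h.pos_dim.ne'
    have harg : ((2 * n : ℕ) : ℂ) * ((φ : ℂ) * I) = Real.pi * I := by
      rw [hφ]
      push_cast
      field_simp
    rw [harg, Complex.exp_pi_mul_I] at hdet
    norm_num at hdet

end Unit

/-! ## §3 `Hg(X)(ℝ) ⊊ S(X)(ℝ)` for central Weil type -/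

section Strict

variable {ι : Type*} [Fintype ι] [DecidableEq ι] {E : Type*} [NormedAddCommGroup E] [NormedSpace ℂ E]
  [FiniteDimensional ℂ E] {Φ : (ι → ℝ) ≃L[ℝ] E} {η : E [⋀^Fin 2]→L[ℝ] ℝ} {α : Matrix ι ι ℚ} {d n : ℕ}

/-- **«THE HODGE GROUP IS STRICTLY CONTAINED IN `Sp_D(V,φ)`» FOR CENTRAL WEIL TYPE**: if `(X, √-d ↦ α)` is of Weil type (the
tangent multiplicities of `k = ℚ(√-d)` are `(n, n)`), `α` is central in `End⁰(X)` and `E` is a polarisation with `ρ(α)^*E = dE`,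
then `Hg(X)(ℝ) ⊊ S(X)(ℝ)`, `S(X)` the centraliser of `End⁰(X)` in `Sp(V, E)` — `Hg(X)(ℝ) ⊆ SU_H(ℝ)` («its elements have trivial
`k`-linear determinant») while `u_{π/2n} ∈ S(X)(ℝ)` has `k`-linear determinant `-1`.
[cite: MoonenZarhin1999LowDim, Thm. (0.1) (1) (p0001 L102–L105) and §5 (5.3) (p0009 L17–L22)] [cite: vanGeemen1994HodgeAV, 6.9 and proof of Thm. 6.11]
[cite: Lange2023AbelianVarietiesComplex, §7.2.4 Exercises (4), (8)] -/
theorem IsWeilType.hodgeGroup_lt_lefschetzGroup_of_forall_comm (h : IsWeilType Φ α d n) (hη : IsRiemannForm Φ η)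
    (hW : ∀ u v : E, η ![analyticRepReal Φ Φ (α.map (Rat.cast : ℚ → ℝ)) u,
      analyticRepReal Φ Φ (α.map (Rat.cast : ℚ → ℝ)) v] = d * η ![u, v])
    (hcent : ∀ A ∈ endAlgRat Φ, α * A = A * α) : hodgeGroup Φ < lefschetzGroup Φ η := by
  obtain ⟨M, hM, hMSU⟩ := h.exists_mem_lefschetzGroup_not_mem_weilSpecialUnitaryGroup hη hW hcent
  refine lt_of_le_of_ne hη.hodgeGroup_le_lefschetzGroup fun heq ↦ hMSU ?_
  exact h.hodgeGroup_le_weilSpecialUnitaryGroup (ofRealForm_mem_hodgeClasses_one_of_isRiemannForm Φ hη) (heq ▸ hM)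

/-- `Hg(X)(ℝ) ≠ S(X)(ℝ)` for central Weil type and a compatible polarisation. [cite: MoonenZarhin1999LowDim, Thm. (0.1) (1) (p0001 L102–L105) and §5 (5.3)] -/
theorem IsWeilType.hodgeGroup_ne_lefschetzGroup_of_forall_comm (h : IsWeilType Φ α d n) (hη : IsRiemannForm Φ η)
    (hW : ∀ u v : E, η ![analyticRepReal Φ Φ (α.map (Rat.cast : ℚ → ℝ)) u,
      analyticRepReal Φ Φ (α.map (Rat.cast : ℚ → ℝ)) v] = d * η ![u, v])
    (hcent : ∀ A ∈ endAlgRat Φ, α * A = A * α) : hodgeGroup Φ ≠ lefschetzGroup Φ η :=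
  (h.hodgeGroup_lt_lefschetzGroup_of_forall_comm hη hW hcent).ne

/-- **`Hg(X)(ℝ) ⊊ S(X)(ℝ)` FOR A POLARISED ABELIAN VARIETY OF WEIL TYPE `(X, K, E)` WITH `K` CENTRAL IN `End⁰(X)`.**
[cite: MoonenZarhin1999LowDim, Thm. (0.1) (1) (p0001 L102–L105) and §5 (5.3) (p0009 L17–L22)] [cite: Lange2023AbelianVarietiesComplex, §7.2.4 (polarised Weil type) and Exercise (8)] -/
theorem IsPolarizedWeilType.hodgeGroup_lt_lefschetzGroup_of_forall_comm (h : IsPolarizedWeilType Φ η α d n)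
    (hcent : ∀ A ∈ endAlgRat Φ, α * A = A * α) : hodgeGroup Φ < lefschetzGroup Φ η :=
  h.toIsWeilType.hodgeGroup_lt_lefschetzGroup_of_forall_comm h.isRiemannForm (fun u v ↦ h.twoForm_analyticRepReal u v) hcent

/-- **Every polarised complex torus of central Weil type carries a polarisation `E` with `Hg(X)(ℝ) ⊊ S(X)(ℝ) = Sp_D(V,E)(ℝ)`**
(a polarisation with `ρ(α)^*E = dE` exists by Lange's Exercise 7.2.4 (7)). [cite: MoonenZarhin1999LowDim, Thm. (0.1) (1) (p0001 L102–L105)]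
[cite: Lange2023AbelianVarietiesComplex, §7.2.4 Exercise (7)] -/
theorem IsWeilType.exists_isRiemannForm_hodgeGroup_lt_lefschetzGroup_of_forall_comm (h : IsWeilType Φ α d n)
    (hA : IsAbelianVariety Φ) (hcent : ∀ A ∈ endAlgRat Φ, α * A = A * α) :
    ∃ θ : E [⋀^Fin 2]→L[ℝ] ℝ, IsRiemannForm Φ θ ∧ hodgeGroup Φ < lefschetzGroup Φ θ := by
  obtain ⟨η₀, hη₀⟩ := hA
  obtain ⟨θ, hθ, hW⟩ := hη₀.exists_isRiemannForm_twoForm_eq_mul h.mem_endAlgRat h.pos h.mul_self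
  exact ⟨θ, hθ, h.hodgeGroup_lt_lefschetzGroup_of_forall_comm hθ hW hcent⟩

end Strict

/-! ## §4 Central Weil type ⟹ stably degenerate -/

section Degenerate

-- universe-`0` carriers: the Hazama–Murty ∕ Gordon criterion (A4-103) runs through the abstract Hodge group of `H¹(X, ℚ)`.
variable {ι : Type} [Fintype ι] [DecidableEq ι] {E : Type} [NormedAddCommGroup E] [NormedSpace ℂ E]
  [FiniteDimensional ℂ E] {Φ : (ι → ℝ) ≃L[ℝ] E} {η : E [⋀^Fin 2]→L[ℝ] ℝ} {α : Matrix ι ι ℚ} {d n : ℕ}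

/-- **A COMPLEX ABELIAN VARIETY OF CENTRAL WEIL TYPE IS STABLY DEGENERATE**: if `X` carries `α ∈ End⁰(X)`, central, with
`α² = -d` and tangent multiplicities `(n, n)`, then `𝒟ᵖ(Xᵏ) ≠ ℬᵖ(Xᵏ)` for some `k, p` — some power of `X` supports a Hodge class
which is not a polynomial in divisor classes («in these cases we have `𝒟²(X) ≠ ℬ²(X)`»: the Weil classes).  From §3 and Gordon's
Thm. 7.5 (1) ⟹ (2) (`Hg = Lf` is necessary for stable nondegeneracy).
[cite: MoonenZarhin1999LowDim, Thm. (0.1) (1) and p0001 L123–L125, §5 (5.3) (p0009 L1–L22), §1 (p0004 L74–L87: Hazama–Murty)]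
[cite: Gordon1999HodgeAVSurvey, Thm. 7.5 (1) ⟺ (2)] [cite: Milne1999LefschetzClasses, §4 Prop. 4.8] -/
theorem IsWeilType.exists_divisorClasses_powPeriod_ne_hodgeClasses_of_forall_comm (h : IsWeilType Φ α d n)
    (hA : IsAbelianVariety Φ) (hcent : ∀ A ∈ endAlgRat Φ, α * A = A * α) :
    ∃ k p : ℕ, divisorClasses (powPeriod Φ k) p ≠ hodgeClasses (powPeriod Φ k) p := by
  obtain ⟨θ, hθ, hlt⟩ := h.exists_isRiemannForm_hodgeGroup_lt_lefschetzGroup_of_forall_comm hA hcent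
  obtain ⟨G, hG⟩ := hθ.exists_ratMatrix_latticeGram
  have hE : 0 < finrank ℂ E := by rw [h.finrank_eq]; have := h.pos_dim; omega
  by_contra hD
  push Not at hD
  exact hlt.ne ((hθ.forall_divisorClasses_powPeriod_eq_hodgeClasses_iff_eq_and_hodgeGroup_eq_lefschetzGroup hG hE).1 hD).2

/-- The same, read as the failure of condition (D): **a complex abelian variety of central Weil type does NOT satisfy
`𝒟•(Xⁿ) = ℬ•(Xⁿ)` for all `n`.** [cite: MoonenZarhin1999LowDim, Thm. (0.1) (1) (p0001 L102–L105, L123–L125) and §1 condition (D) (p0004 L61–L66)]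
[cite: Gordon1999HodgeAVSurvey, Thm. 7.5 and Def. 7.6] -/
theorem IsAbelianVariety.not_forall_divisorClasses_powPeriod_eq_hodgeClasses_of_isWeilType_of_forall_comm
    (hA : IsAbelianVariety Φ) (h : IsWeilType Φ α d n) (hcent : ∀ A ∈ endAlgRat Φ, α * A = A * α) :
    ¬ ∀ k p : ℕ, divisorClasses (powPeriod Φ k) p = hodgeClasses (powPeriod Φ k) p := by
  obtain ⟨k, p, hkp⟩ := h.exists_divisorClasses_powPeriod_ne_hodgeClasses_of_forall_comm hA hcent
  exact fun hD ↦ hkp (hD k p)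

/-- **… and for EVERY polarisation `E` of such an `X`, `Hg(X)(ℝ) = S(X)(ℝ)` together with the connectedness of `S(X)(ℂ)` fails**
(the pair of conditions equivalent to (D)). [cite: Gordon1999HodgeAVSurvey, Thm. 7.5 (1) ⟺ (2)] [cite: MoonenZarhin1999LowDim, Thm. (0.1) (1)] -/
theorem IsWeilType.not_lefschetzIdentityC_eq_and_hodgeGroup_eq_lefschetzGroup_of_forall_comm (h : IsWeilType Φ α d n)
    (hη : IsRiemannForm Φ η) {G : Matrix ι ι ℚ} (hG : G.map (Rat.cast : ℚ → ℝ) = latticeGram Φ η)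
    (hcent : ∀ A ∈ endAlgRat Φ, α * A = A * α) :
    ¬ (lefschetzIdentityC Φ G = lefschetzGroupC Φ G ∧ hodgeGroup Φ = lefschetzGroup Φ η) := by
  have hE : 0 < finrank ℂ E := by rw [h.finrank_eq]; have := h.pos_dim; omega
  rw [← hη.forall_divisorClasses_powPeriod_eq_hodgeClasses_iff_eq_and_hodgeGroup_eq_lefschetzGroup hG hE]
  exact IsAbelianVariety.not_forall_divisorClasses_powPeriod_eq_hodgeClasses_of_isWeilType_of_forall_comm ⟨η, hη⟩ h hcent

end Degenerate

end ComplexTorus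

end Literature.Geometry.Kaehler
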